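import Summits.CriticalPhenomena.PercolationContinuityZ3.Theorems.PercAnnulusCrossingIICSprinkledWLLN
import HarnessLib

/-!
# A second-moment Borel–Cantelli lemma: decorrelated witnesses of probability `≥ c` occur infinitely often (lane RSW3, p1 gen 14)

builds on p205010 (kernel theorem, internal audit signed; external expert review pending) — NOT used here: this file is abstract
measure theory (any probability space); it is the engine of gen 14's almost-sure recurrence theorems for Kesten's IIC.

Seat `prim-rsw3-p1` (gen 14); memo `run/shared/lean/prim/rsw3/P1-QM.md` §27.  Helper file for the crux `stmt-CriticalPhenomena-4575` chain;
no definitions, no sorries.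

For events `X_v`, `v ∈ S` (finite), of a probability space with `μ(X_v) ≥ c > 0` and PAIRWISE DECORRELATION
`μ(X_v ∩ X_w) ≤ μ(X_v)μ(X_w) + δ` (`v ≠ w`), Chebyshev's inequality for the empirical density `|S|⁻¹ Σ_v 1_{X_v}` (gen 13's
`sq_mul_real_density_deviation_le`) gives

* `sum_sum_real_inter_le_of_pairwise` — `Σ_v Σ_w μ(X_v ∩ X_w) ≤ |S| + (Σ_v μ(X_v))² + |S|²δ`;
* **`real_iInter_compl_le_of_pairwise`** — `μ(⋂_{v ∈ S} X_vᶜ) ≤ (1/|S| + δ)/c²`: many pairwise-decorrelated events of probability `≥ c`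
  cannot all fail.

Hence the two Borel–Cantelli statements used by the lane (the classical second Borel–Cantelli lemma needs independence; the
Erdős–Rényi / Kochen–Stone versions need asymptotic pairwise decorrelation, which is what a MIXING measure supplies):

* **`ae_frequently_mem_of_forall_exists_decorrelated`** — if beyond every index `M`, for every finite family `F` of events and every
  `δ > 0`, some `U_k` (`k ≥ M`) contains a measurable WITNESS `W` with `μ(W) ≥ c` and `μ(A ∩ W) ≤ μ(A)μ(W) + δ` for all `A ∈ F`, then
  `μ`-a.s. `ω ∈ U_k` for infinitely many `k` (inductive selection of `N` pairwise-decorrelated witnesses, then `N → ∞`, `δ → 0`);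
* **`ae_frequently_mem_of_eventually_decorrelated`** — the pairwise form: measurable `U_k` with `μ(U_k) ≥ c` eventually and, for each `j`,
  `μ(U_j ∩ U_k) ≤ μ(U_j)μ(U_k) + δ` for all large `k` (every `δ > 0`) occur infinitely often almost surely.

References: P. Erdős, A. Rényi, On Cantor's series with convergent Σ1/q_n (1959); S. Kochen, C. Stone, Ill. J. Math. 8 (1964) 248–251;
R. Durrett, *Probability: Theory and Examples*, Thm. 2.3.8 / Ex. 2.3.13 [folklore].
-/

noncomputable section

namespace Summit.CriticalPhenomena.PercolationContinuityZ3.Theorems.Crossing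

open MeasureTheory Filter Topology
open scoped ENNReal

section BorelCantelli

variable {Ω : Type*} [MeasurableSpace Ω] (μ : Measure Ω) [IsProbabilityMeasure μ]

/-- **`Σ_v Σ_w μ(X_v ∩ X_w) ≤ |S| + (Σ_v μ(X_v))² + |S|²·δ`** for finitely many events with pairwise decorrelation
`μ(X_v ∩ X_w) ≤ μ(X_v)μ(X_w) + δ` (`v ≠ w`): the diagonal is at most `|S|`. [folklore] -/
theorem sum_sum_real_inter_le_of_pairwise {ι : Type*} (S : Finset ι) (X : ι → Set Ω) {δ : ℝ} (hδ : 0 ≤ δ)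
    (h : ∀ v ∈ S, ∀ w ∈ S, v ≠ w → μ.real (X v ∩ X w) ≤ μ.real (X v) * μ.real (X w) + δ) :
    ∑ v ∈ S, ∑ w ∈ S, μ.real (X v ∩ X w) ≤
      (S.card : ℝ) + (∑ v ∈ S, μ.real (X v)) ^ 2 + (S.card : ℝ) ^ 2 * δ := by
  classical
  have hterm : ∀ v ∈ S, ∀ w ∈ S,
      μ.real (X v ∩ X w) ≤ (if v = w then (1 : ℝ) else 0) + μ.real (X v) * μ.real (X w) + δ := by
    intro v hv w hw
    by_cases hvw : v = w
    · subst hvw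
      rw [if_pos rfl, Set.inter_self]
      have h1 : μ.real (X v) ≤ 1 := measureReal_le_one
      nlinarith [measureReal_nonneg (μ := μ) (s := X v)]
    · rw [if_neg hvw, zero_add]
      exact h v hv w hw hvw
  calc ∑ v ∈ S, ∑ w ∈ S, μ.real (X v ∩ X w)
      ≤ ∑ v ∈ S, ∑ w ∈ S, ((if v = w then (1 : ℝ) else 0) + μ.real (X v) * μ.real (X w) + δ) :=
        Finset.sum_le_sum fun v hv => Finset.sum_le_sum fun w hw => hterm v hv w hw
    _ = (S.card : ℝ) + (∑ v ∈ S, μ.real (X v)) ^ 2 + (S.card : ℝ) ^ 2 * δ := by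
        simp only [Finset.sum_add_distrib, Finset.sum_ite_eq, Finset.sum_const, nsmul_eq_mul, Finset.sum_boole]
        rw [sq, Finset.sum_mul_sum, Finset.filter_mem_eq_inter, Finset.inter_self]
        ring

/-- **Many pairwise-decorrelated events of probability `≥ c` cannot all fail**: if `μ(X_v) ≥ c > 0` for `v ∈ S ≠ ∅` and
`μ(X_v ∩ X_w) ≤ μ(X_v)μ(X_w) + δ` for `v ≠ w`, then `μ(⋂_{v ∈ S} X_vᶜ) ≤ (1/|S| + δ)/c²` (Chebyshev for the empirical density
`|S|⁻¹ Σ 1_{X_v}`, which vanishes on `⋂ X_vᶜ` and has mean `≥ c` and variance `≤ 1/|S| + δ`). [folklore] -/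
theorem real_iInter_compl_le_of_pairwise {ι : Type*} (S : Finset ι) (hS : S.Nonempty) (X : ι → Set Ω)
    (hX : ∀ v, MeasurableSet (X v)) {c δ : ℝ} (hc : 0 < c) (hδ : 0 ≤ δ) (hcX : ∀ v ∈ S, c ≤ μ.real (X v))
    (h : ∀ v ∈ S, ∀ w ∈ S, v ≠ w → μ.real (X v ∩ X w) ≤ μ.real (X v) * μ.real (X w) + δ) :
    μ.real (⋂ v ∈ S, (X v)ᶜ) ≤ (1 / S.card + δ) / c ^ 2 := by
  classical
  have hN : (0 : ℝ) < S.card := by exact_mod_cast hS.card_pos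
  set m : ℝ := (∑ v ∈ S, μ.real (X v)) / (S.card : ℝ) with hm
  have hcm : c ≤ m := by
    rw [hm, le_div_iff₀ hN]
    calc c * (S.card : ℝ) = ∑ _v ∈ S, c := by rw [Finset.sum_const, nsmul_eq_mul, mul_comm]
      _ ≤ ∑ v ∈ S, μ.real (X v) := Finset.sum_le_sum hcX
  have hm0 : 0 < m := hc.trans_le hcm
  -- Chebyshev at level `η = m` around `t = m`
  have hcheb := sq_mul_real_density_deviation_le μ S X hX m hm0
  have hsub : (⋂ v ∈ S, (X v)ᶜ) ⊆
      {x | m ≤ |(∑ v ∈ S, (X v).indicator (1 : Ω → ℝ) x) / (S.card : ℝ) - m|} := by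
    intro x hx
    have hx' : ∀ v ∈ S, x ∉ X v := by simpa only [Set.mem_iInter, Set.mem_compl_iff] using hx
    have h0 : ∑ v ∈ S, (X v).indicator (1 : Ω → ℝ) x = 0 :=
      Finset.sum_eq_zero fun v hv => Set.indicator_of_notMem (hx' v hv) _
    simp only [Set.mem_setOf_eq, h0, zero_div, zero_sub, abs_neg, abs_of_pos hm0, le_refl]
  have hsum := sum_sum_real_inter_le_of_pairwise μ S X hδ h
  have hvar : (∑ v ∈ S, ∑ w ∈ S, μ.real (X v ∩ X w)) / (S.card : ℝ) ^ 2 - 2 * m * ((∑ v ∈ S, μ.real (X v)) / (S.card : ℝ)) + m ^ 2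
      ≤ 1 / S.card + δ := by
    rw [← hm]
    have h1 : (∑ v ∈ S, ∑ w ∈ S, μ.real (X v ∩ X w)) / (S.card : ℝ) ^ 2 ≤ 1 / S.card + m ^ 2 + δ := by
      rw [div_le_iff₀ (pow_pos hN 2)]
      have h2 : (1 / S.card + m ^ 2 + δ) * (S.card : ℝ) ^ 2 = (S.card : ℝ) + (∑ v ∈ S, μ.real (X v)) ^ 2 + (S.card : ℝ) ^ 2 * δ := by
        rw [hm]; field_simp
      rw [h2]; exact hsum
    nlinarith
  have hle : m ^ 2 * μ.real (⋂ v ∈ S, (X v)ᶜ) ≤ 1 / S.card + δ :=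
    le_trans (mul_le_mul_of_nonneg_left (measureReal_mono hsub) (sq_nonneg m)) (hcheb.trans hvar)
  have hm2 : 0 < m ^ 2 := pow_pos hm0 2
  have hcm2 : c ^ 2 ≤ m ^ 2 := pow_le_pow_left₀ hc.le hcm 2
  have hnum : 0 ≤ 1 / (S.card : ℝ) + δ := add_nonneg (by positivity) hδ
  calc μ.real (⋂ v ∈ S, (X v)ᶜ) ≤ (1 / S.card + δ) / m ^ 2 := by rw [le_div_iff₀ hm2, mul_comm]; exact hle
    _ ≤ (1 / S.card + δ) / c ^ 2 := div_le_div_of_nonneg_left hnum (pow_pos hc 2) hcm2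


/-! ## From finite families of decorrelated witnesses to almost-sure recurrence -/

/-- **Core step.**  If for every index `M`, every `N` and every `δ > 0` there are `N` measurable events of probability `≥ c > 0`, each
contained in `⋃_{k ≥ M} U_k`, with pairwise decorrelation `μ(w_i ∩ w_j) ≤ μ(w_i)μ(w_j) + δ` (`i ≠ j`), then `μ`-a.s. `ω ∈ U_k` for
infinitely many `k`: by `real_iInter_compl_le_of_pairwise`, `μ(⋂_{k ≥ M} U_kᶜ) ≤ (1/N + δ)/c²` for all `N, δ`. [folklore] -/
theorem ae_frequently_mem_of_forall_exists_fin (U : ℕ → Set Ω) {c : ℝ} (hc : 0 < c)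
    (hw : ∀ (M N : ℕ) (δ : ℝ), 0 < δ → ∃ w : Fin N → Set Ω, (∀ i, MeasurableSet (w i)) ∧ (∀ i, c ≤ μ.real (w i)) ∧
      (∀ i, w i ⊆ ⋃ k ≥ M, U k) ∧ ∀ i j, i ≠ j → μ.real (w i ∩ w j) ≤ μ.real (w i) * μ.real (w j) + δ) :
    ∀ᵐ ω ∂μ, ∃ᶠ k in atTop, ω ∈ U k := by
  classical
  -- the exceptional sets `T_M = {ω | ∀ k ≥ M, ω ∉ U k}` are null
  have hT : ∀ M : ℕ, μ {ω | ∀ k, M ≤ k → ω ∉ U k} = 0 := by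
    intro M
    set T : Set Ω := {ω | ∀ k, M ≤ k → ω ∉ U k} with hTdef
    have hbound : ∀ N : ℕ, 1 ≤ N → μ.real T ≤ 2 / ((N : ℝ) * c ^ 2) := by
      intro N hN
      have hN0 : (0 : ℝ) < N := by exact_mod_cast hN
      have hδ : (0 : ℝ) < 1 / N := by positivity
      obtain ⟨w, hwm, hwc, hwU, hwd⟩ := hw M N (1 / N) hδ
      haveI : Nonempty (Fin N) := ⟨⟨0, hN⟩⟩
      have hne : (Finset.univ : Finset (Fin N)).Nonempty := Finset.univ_nonempty
      have hle := real_iInter_compl_le_of_pairwise μ Finset.univ hne w hwm hc hδ.le (fun i _ => hwc i)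
        (fun i _ j _ hij => hwd i j hij)
      have hsub : T ⊆ ⋂ v ∈ (Finset.univ : Finset (Fin N)), (w v)ᶜ := by
        intro ω hω
        simp only [Set.mem_iInter, Set.mem_compl_iff]
        intro i _ hωi
        have hωU := hwU i hωi
        simp only [Set.mem_iUnion, exists_prop] at hωU
        obtain ⟨k, hk, hωk⟩ := hωU
        exact hω k hk hωk
      calc μ.real T ≤ μ.real (⋂ v ∈ (Finset.univ : Finset (Fin N)), (w v)ᶜ) := measureReal_mono hsub
        _ ≤ (1 / (Finset.univ : Finset (Fin N)).card + 1 / N) / c ^ 2 := hle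
        _ = 2 / ((N : ℝ) * c ^ 2) := by rw [Finset.card_univ, Fintype.card_fin]; field_simp; ring
    have hlim : Tendsto (fun N : ℕ => 2 / ((N : ℝ) * c ^ 2)) atTop (𝓝 0) := by
      have h1 : Tendsto (fun N : ℕ => (N : ℝ) * c ^ 2) atTop atTop :=
        tendsto_natCast_atTop_atTop.atTop_mul_const (pow_pos hc 2)
      exact tendsto_const_nhds.div_atTop h1
    have hreal : μ.real T ≤ 0 :=
      ge_of_tendsto hlim (Filter.eventually_atTop.2 ⟨1, fun N hN => hbound N hN⟩)
    have h0 : μ.real T = 0 := le_antisymm hreal measureReal_nonneg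
    exact (measureReal_eq_zero_iff (measure_ne_top μ T)).1 h0
  have hnull : μ (⋃ M : ℕ, {ω | ∀ k, M ≤ k → ω ∉ U k}) = 0 := measure_iUnion_null hT
  refine measure_mono_null (fun ω hω => ?_) hnull
  -- `ω` with only finitely many visits lies in some `T_M`
  have hω' : ¬ ∃ᶠ k in atTop, ω ∈ U k := hω
  rw [Filter.not_frequently, Filter.eventually_atTop] at hω'
  obtain ⟨M, hM⟩ := hω'
  exact Set.mem_iUnion.2 ⟨M, fun k hk => hM k hk⟩

/-- **Second Borel–Cantelli lemma with decorrelated witnesses.**  Let `c > 0`.  Suppose that beyond every index `M`, for every finite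
family `F` of measurable events and every `δ > 0`, some `U_k` (`k ≥ M`) contains a measurable witness `W` with `μ(W) ≥ c` and
`μ(A ∩ W) ≤ μ(A)·μ(W) + δ` for every `A ∈ F`.  Then `μ`-almost surely `ω ∈ U_k` for infinitely many `k`
(select inductively `N` pairwise-decorrelated witnesses and apply the core step). [folklore] -/
theorem ae_frequently_mem_of_forall_exists_decorrelated (U : ℕ → Set Ω) {c : ℝ} (hc : 0 < c)
    (h : ∀ (F : Finset (Set Ω)), (∀ A ∈ F, MeasurableSet A) → ∀ δ : ℝ, 0 < δ → ∀ M : ℕ,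
      ∃ k, M ≤ k ∧ ∃ W : Set Ω, W ⊆ U k ∧ MeasurableSet W ∧ c ≤ μ.real W ∧
        ∀ A ∈ F, μ.real (A ∩ W) ≤ μ.real A * μ.real W + δ) :
    ∀ᵐ ω ∂μ, ∃ᶠ k in atTop, ω ∈ U k := by
  classical
  refine ae_frequently_mem_of_forall_exists_fin μ U hc fun M N δ hδ => ?_
  induction N with
  | zero => exact ⟨fun i => i.elim0, fun i => i.elim0, fun i => i.elim0, fun i => i.elim0, fun i => i.elim0⟩
  | succ N ih =>
    obtain ⟨w, hwm, hwc, hwU, hwd⟩ := ih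
    obtain ⟨k, hk, W, hWU, hWm, hWc, hWd⟩ := h (Finset.univ.image w)
      (fun A hA => by
        obtain ⟨i, -, rfl⟩ := Finset.mem_image.1 hA
        exact hwm i) δ hδ M
    have hWd' : ∀ i : Fin N, μ.real (w i ∩ W) ≤ μ.real (w i) * μ.real W + δ :=
      fun i => hWd (w i) (Finset.mem_image_of_mem w (Finset.mem_univ i))
    have hWU' : W ⊆ ⋃ k ≥ M, U k := fun ω hω => Set.mem_iUnion₂.2 ⟨k, hk, hWU hω⟩
    refine ⟨Fin.snoc w W, fun i => ?_, fun i => ?_, fun i => ?_, fun i j hij => ?_⟩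
    · rcases Fin.eq_castSucc_or_eq_last i with ⟨a, rfl⟩ | rfl
      · rw [Fin.snoc_castSucc]; exact hwm a
      · rw [Fin.snoc_last]; exact hWm
    · rcases Fin.eq_castSucc_or_eq_last i with ⟨a, rfl⟩ | rfl
      · rw [Fin.snoc_castSucc]; exact hwc a
      · rw [Fin.snoc_last]; exact hWc
    · rcases Fin.eq_castSucc_or_eq_last i with ⟨a, rfl⟩ | rfl
      · rw [Fin.snoc_castSucc]; exact hwU a
      · rw [Fin.snoc_last]; exact hWU'
    · rcases Fin.eq_castSucc_or_eq_last i with ⟨a, rfl⟩ | rfl <;>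
        rcases Fin.eq_castSucc_or_eq_last j with ⟨b, rfl⟩ | rfl
      · rw [Fin.snoc_castSucc, Fin.snoc_castSucc]
        exact hwd a b fun hab => hij (by rw [hab])
      · rw [Fin.snoc_castSucc, Fin.snoc_last]; exact hWd' a
      · rw [Fin.snoc_castSucc, Fin.snoc_last, Set.inter_comm, mul_comm]; exact hWd' b
      · exact absurd rfl hij

/-- **Second Borel–Cantelli lemma under asymptotic pairwise decorrelation** (Erdős–Rényi / Kochen–Stone type): measurable events
`U_k` with `μ(U_k) ≥ c > 0` for all large `k` such that, for each `j` and each `δ > 0`, `μ(U_j ∩ U_k) ≤ μ(U_j)μ(U_k) + δ` for all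
large `k`, occur infinitely often almost surely. [folklore] -/
theorem ae_frequently_mem_of_eventually_decorrelated (U : ℕ → Set Ω) (hU : ∀ k, MeasurableSet (U k)) {c : ℝ} (hc : 0 < c)
    (hcU : ∀ᶠ k in atTop, c ≤ μ.real (U k))
    (hdec : ∀ (j : ℕ) (δ : ℝ), 0 < δ → ∀ᶠ k in atTop, μ.real (U j ∩ U k) ≤ μ.real (U j) * μ.real (U k) + δ) :
    ∀ᵐ ω ∂μ, ∃ᶠ k in atTop, ω ∈ U k := by
  classical
  refine ae_frequently_mem_of_forall_exists_fin μ U hc fun M N δ hδ => ?_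
  -- select indices `κ : Fin N → ℕ`, all `≥ M`, with `μ(U_κi) ≥ c` and pairwise decorrelation
  have hsel : ∃ κ : Fin N → ℕ, (∀ i, M ≤ κ i) ∧ (∀ i, c ≤ μ.real (U (κ i))) ∧
      ∀ i j, i ≠ j → μ.real (U (κ i) ∩ U (κ j)) ≤ μ.real (U (κ i)) * μ.real (U (κ j)) + δ := by
    induction N with
    | zero => exact ⟨fun i => i.elim0, fun i => i.elim0, fun i => i.elim0, fun i => i.elim0⟩
    | succ N ih =>
      obtain ⟨κ, hκM, hκc, hκd⟩ := ih
      have hev : ∀ᶠ k in atTop, c ≤ μ.real (U k) ∧ M ≤ k ∧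
          ∀ i ∈ (Finset.univ : Finset (Fin N)), μ.real (U (κ i) ∩ U k) ≤ μ.real (U (κ i)) * μ.real (U k) + δ ∧ κ i < k := by
        refine hcU.and ((eventually_ge_atTop M).and ?_)
        exact (Finset.eventually_all _).2 fun i _ => (hdec (κ i) δ hδ).and (eventually_gt_atTop (κ i))
      obtain ⟨k, hkc, hkM, hk⟩ := hev.exists
      refine ⟨Fin.snoc κ k, fun i => ?_, fun i => ?_, fun i j hij => ?_⟩
      · rcases Fin.eq_castSucc_or_eq_last i with ⟨a, rfl⟩ | rfl
        · rw [Fin.snoc_castSucc]; exact hκM a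
        · rw [Fin.snoc_last]; exact hkM
      · rcases Fin.eq_castSucc_or_eq_last i with ⟨a, rfl⟩ | rfl
        · rw [Fin.snoc_castSucc]; exact hκc a
        · rw [Fin.snoc_last]; exact hkc
      · rcases Fin.eq_castSucc_or_eq_last i with ⟨a, rfl⟩ | rfl <;>
          rcases Fin.eq_castSucc_or_eq_last j with ⟨b, rfl⟩ | rfl
        · rw [Fin.snoc_castSucc, Fin.snoc_castSucc]
          exact hκd a b fun hab => hij (by rw [hab])
        · rw [Fin.snoc_castSucc, Fin.snoc_last]; exact (hk a (Finset.mem_univ a)).1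
        · rw [Fin.snoc_castSucc, Fin.snoc_last, Set.inter_comm, mul_comm]; exact (hk b (Finset.mem_univ b)).1
        · exact absurd rfl hij
  obtain ⟨κ, hκM, hκc, hκd⟩ := hsel
  refine ⟨fun i => U (κ i), fun i => hU _, hκc, fun i => ?_, hκd⟩
  exact fun ω hω => Set.mem_iUnion₂.2 ⟨κ i, hκM i, hω⟩

end BorelCantelli

end Summit.CriticalPhenomena.PercolationContinuityZ3.Theorems.Crossing

end
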